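import Summits.BirchSwinnertonDyer.Rank1Residual.GaloisImage.SelmerPairCounting
import Summits.BirchSwinnertonDyer.Rank1Residual.GaloisImage.PropagatedStructureKummerEq
import Summits.BirchSwinnertonDyer.Rank1Residual.X11b.KummerStructureDuality
import Literature.NumberTheory.GaloisCohomology.KolyvaginSystems
import Literature.NumberTheory.EllipticCurves.ArchimedeanKummerImageMaximal
import Literature.NumberTheory.EllipticCurves.CongruenceVisibilityLocalFactors
import Literature.NumberTheory.GaloisRepresentations.RatPlaceTwoProofs
import HarnessLib

/-!
# Core rank one of `𝓕_can` on `E[3]`: `χ(𝓕̄) = 1` (Sakamoto 2024 Def. 3.6, hypothesis of Thm. 4.4)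
# (cell `b2b-bsdres`, team n1011, row T-a3-F1, items CR2–CR4 of skel/T-a3-F1-CR.md)

Honest framing of the cell: research route; theorems only; no named fact is minted; no definition.  CONDITIONAL
on (i) the Poitou–Tate properties `IsPerfect`, `SumLocalTermEqZero`, `SelmerComplement` of the
family `inv` (the cited fact `poitouTate_selmerStructure_duality ℚ`), (ii) the residual self-duality
COUNT of the classical `3`-descent structure `#Sel^{(3)}(E/ℚ) = #H¹_{𝓚^*}(ℚ, E[3]^D)` and its
finiteness (binders `hKfin`, `hKSD`; theorems of the tree's X11b/p18 files for the Weil transport,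
kept as binders here), (iii) the bounded exponent of `H¹(ℚ_ℓ, E)[3^∞]` at `ℓ ≠ 3` (binder `hbd`, as
in n1011-p06's `PropagatedStructureKummerEq`), and (iv) **the located local gap (Lp) at `3`**, in
the print-shaped form ruled by referee 1 (2026-08-21): `hLpIm : #im(H¹(ℚ₃, T₃E) → H¹(ℚ₃, E[3])) =
9 · #E(ℚ₃)[3]` (Greenberg LNM 1716 §2: `rank_{ℤ₃} H¹(ℚ₃, T₃E) = 2`; not in the tree).  The second
print-shaped local input `#E(ℚ₃)/3E(ℚ₃) = 3 · #E(ℚ₃)[3]` is the tree's THEOREM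
`natCard_kummerLocalConditionAt_adicCompletion` (Milne ADT I Lemma 3.3) and is discharged here.

## Statement (`hasCoreRank_one_propagatedSelmerStructureOne`)

Under (i)–(iv): `LocalInvariants.HasCoreRank inv (propagatedSelmerStructureOne W 3) 3 1`, i.e.
`#H¹_{𝓕̄}(ℚ, E[3]) = 3 · #H¹_{𝓕̄^*}(ℚ, E[3]^D)` for `𝓕̄ = propagatedSelmerStructureOne W 3` = the
residual structure of `𝓕_can` (p13 `induced_propagatedSelmerStructure`) — Sakamoto's "`χ(𝓕) = 1`".

## Proof (skel/T-a3-F1-CR.md §2, route (G2))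

Compare `𝓕̄` with the Kummer structure `𝓚 = kummerSelmerStructure 3` on `E[3]`: `𝓚 ≤ 𝓕̄`
(n1011-p18 `kummerSelmerStructure_le_propagatedSelmerStructureOne`), `𝓕̄_ℓ = 𝓚_ℓ` at `ℓ ≠ 3`
(n1011-p06 `propagatedSelmerStructureOne_inr_eq_kummerSelmerStructure`), both `0` at `∞` (odd `3`),
`𝓚` unramified outside `∞ ∪ {3} ∪ bad` (X11b `kummerSelmerStructure_isUnramifiedOutside`); the
pair-counting identity `card_selmerGroup_pair` (this session's `SelmerPairCounting`) gives
`#H¹_{𝓕̄} · #H¹_{𝓚*} · ∏_T #𝓚_v = #H¹_𝓚 · #H¹_{𝓕̄*} · ∏_T #𝓕̄_v`; the local products differ exactly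
at the place `3`, by `#𝓕̄_3 / #𝓚_3 = 9·#E(ℚ₃)[3] / (3·#E(ℚ₃)[3]) = 3`; cancel `#H¹_𝓚 = #H¹_{𝓚*}`.

References: Sakamoto 2024 Def. 3.6, §9; Mazur–Rubin, Mem. AMS 799 Prop. 6.2.2; Milne ADT I 3.3.
-/

noncomputable section

open scoped Classical NumberField
open Function NumberField IsDedekindDomain WeierstrassCurve
open Literature.NumberTheory.EllipticCurves Literature.NumberTheory.GaloisRepresentations
  Literature.NumberTheory.GaloisRepresentations.DiscreteGaloisModule Literature.NumberTheory.GaloisCohomology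
open Summit.BirchSwinnertonDyer.Rank1Residual.X11b

namespace Summit.BirchSwinnertonDyer.Rank1Residual.GaloisImage

variable (W : WeierstrassCurve ℚ) [W.IsElliptic]

/-! ### The place `3` of `ℚ` -/

/-- There is exactly one finite place of `ℚ` above `3`; any two coincide. [folklore] -/
theorem heightOneSpectrum_eq_of_three_mem {v w : HeightOneSpectrum (𝓞 ℚ)}
    (hv : ((3 : ℕ) : 𝓞 ℚ) ∈ v.asIdeal) (hw : ((3 : ℕ) : 𝓞 ℚ) ∈ w.asIdeal) : v = w := by
  apply HeightOneSpectrum.ext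
  rw [Rat.asIdeal_eq_span_natGenerator v, Rat.asIdeal_eq_span_natGenerator w,
    Rat.natGenerator_eq_of_prime_mem v Nat.prime_three hv,
    Rat.natGenerator_eq_of_prime_mem w Nat.prime_three hw]

/-- `3 ∈ 𝔭_{(3)}` for the place `(3)` of `ℚ` (Mathlib's `primesEquiv.symm 3`). [folklore] -/
theorem three_mem_primesEquiv_symm_three :
    ((3 : ℕ) : 𝓞 ℚ) ∈ ((Rat.HeightOneSpectrum.primesEquiv (R := 𝓞 ℚ)).symm ⟨3, Nat.prime_three⟩).asIdeal := by
  set v₃ := (Rat.HeightOneSpectrum.primesEquiv (R := 𝓞 ℚ)).symm ⟨3, Nat.prime_three⟩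
  have h : Rat.HeightOneSpectrum.natGenerator v₃ = 3 := by
    have := (Rat.HeightOneSpectrum.primesEquiv (R := 𝓞 ℚ)).apply_symm_apply ⟨3, Nat.prime_three⟩
    exact congrArg Subtype.val this
  rw [Rat.asIdeal_eq_span_natGenerator v₃, h]
  exact Ideal.subset_span rfl

/-- `#(ℤ₃ / 3ℤ₃) = 3`. [folklore] -/
theorem natCard_quot_adicCompletionIntegers_three {v : HeightOneSpectrum (𝓞 ℚ)}
    (hv : ((3 : ℕ) : 𝓞 ℚ) ∈ v.asIdeal) :
    Nat.card (v.adicCompletionIntegers ℚ ⧸ Ideal.span {((3 : ℕ) : v.adicCompletionIntegers ℚ)}) = 3 := by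
  haveI : Fact (Nat.Prime 3) := ⟨Nat.prime_three⟩
  have h := prod_natCard_quot_adicCompletionIntegers (K := ℚ) (p := 3) {v} (fun w hw h3 =>
    hw (Finset.mem_singleton.mpr (heightOneSpectrum_eq_of_three_mem h3 hv)))
  rwa [Finset.prod_singleton, Module.finrank_self, pow_one] at h

/-! ### The core rank -/

/-- **`χ(𝓕_can) = 1` — core rank one of the propagated structure on `E[3]`** (Sakamoto 2024
Def. 3.6 / hypothesis "`χ(𝓕) = 1`" of Thm. 4.4, for the N11 instance): for an elliptic curve
`E/ℚ`, a Poitou–Tate family `inv` of local invariants mod `3` (`IsPerfect`, `SumLocalTermEqZero`,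
`SelmerComplement`), a finite set `T` of finite places containing `3` and the bad places, the
bounded exponent of `H¹(ℚ_ℓ, E)[3^∞]` at every `ℓ ≠ 3` (`hbd`), the finiteness and residual
self-duality count of the `3`-descent structure `𝓚` (`hKfin`, `hKSD`), and the local input (Lp)
`#𝓕̄_3 = 9 · #E(ℚ₃)[3]` (`hLpIm`, Greenberg LNM 1716 §2 — the one located gap of the hypothesis
side, explicit): `#H¹_{𝓕̄}(ℚ, E[3]) = 3 · #H¹_{𝓕̄^*}(ℚ, E[3]^D)` for
`𝓕̄ = propagatedSelmerStructureOne W 3`. [cite: Sakamoto2024, Def. 3.6 (p. 923) and Thm. 4.4 (p. 926)] -/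
theorem hasCoreRank_one_propagatedSelmerStructureOne [Finite (geomTorsion W ((3 : ℕ) : ℤ))]
    (inv : LocalInvariants ℚ 3) (hperf : inv.IsPerfect) (hsum : inv.SumLocalTermEqZero)
    (hcompl : inv.SelmerComplement)
    (T : Finset (HeightOneSpectrum (𝓞 ℚ)))
    (h3T : ∀ v : HeightOneSpectrum (𝓞 ℚ), ((3 : ℕ) : 𝓞 ℚ) ∈ v.asIdeal → v ∈ T)
    (hbadT : ∀ v : HeightOneSpectrum (𝓞 ℚ), ¬ W.HasGoodReductionAt v → v ∈ T)
    (hbd : ∀ v : HeightOneSpectrum (𝓞 ℚ), ((3 : ℕ) : 𝓞 ℚ) ∉ v.asIdeal →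
      ∃ N : ℕ, ∀ c : galoisCohomology (W.localGaloisModule
        (Place.Completion (Sum.inr v : Place ℚ))) 1,
        (∃ k : ℕ, ((3 ^ k : ℕ) : ℤ) • c = 0) → ((3 ^ N : ℕ) : ℤ) • c = 0)
    (hKfin : Finite (W.kummerSelmerStructure ((3 : ℕ) : ℤ)).selmerGroup)
    (hKSD : Nat.card (W.kummerSelmerStructure ((3 : ℕ) : ℤ)).selmerGroup =
      Nat.card (inv.dualSelmerStructure (W.torsionGaloisModule ((3 : ℕ) : ℤ))
        (W.kummerSelmerStructure ((3 : ℕ) : ℤ))).selmerGroup)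
    (hLpIm : ∀ v : HeightOneSpectrum (𝓞 ℚ), ((3 : ℕ) : 𝓞 ℚ) ∈ v.asIdeal →
      Nat.card (propagatedSelmerStructureOne W 3 (Sum.inr v)) =
        9 * Nat.card (nsmulAddMonoidHom 3 :
          (W.baseChange (v.adicCompletion ℚ)).toAffine.Point →+ _).ker) :
    LocalInvariants.HasCoreRank inv (propagatedSelmerStructureOne W 3) 3 1 := by
  haveI : Fact (Nat.Prime 3) := ⟨Nat.prime_three⟩
  set 𝓚 := W.kummerSelmerStructure ((3 : ℕ) : ℤ) with h𝓚def
  set 𝓖 := propagatedSelmerStructureOne W 3 with h𝓖def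
  -- inputs of the pair count
  have hM : ∀ m : geomTorsion W ((3 : ℕ) : ℤ), (3 : ℕ) • m = 0 := fun m => AddSubgroup.torsionBy.nsmul m
  have hle : 𝓚 ≤ 𝓖 := fun v => kummerSelmerStructure_le_propagatedSelmerStructureOne W 3 v
  have hS : ∀ v : HeightOneSpectrum (𝓞 ℚ), v ∉ T →
      (((3 : ℕ) : ℕ) : 𝓞 ℚ) ∉ v.asIdeal ∧ GaloisRep.IsUnramifiedAt v (W.torsionGaloisModule ((3 : ℕ) : ℤ)) := by
    intro v hv
    have h3 : ((3 : ℕ) : 𝓞 ℚ) ∉ v.asIdeal := fun h => hv (h3T v h)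
    have hgood : W.HasGoodReductionAt v := by by_contra h; exact hv (hbadT v h)
    exact ⟨h3, AcSelmer.isUnramifiedAt_torsionGaloisModule W hgood (by rwa [Int.cast_natCast])⟩
  have h𝓚unr : 𝓚.IsUnramifiedOutside (finSupport T) := by
    have h := KummerDuality.kummerSelmerStructure_isUnramifiedOutside W 3 1 (finSupport T)
      (inl_mem_finSupport T) (fun v hv => (inr_mem_finSupport_iff T v).mpr (h3T v hv))
      (fun v hv => (inr_mem_finSupport_iff T v).mpr (hbadT v hv))
    rwa [pow_one] at h
  have heq : ∀ v : HeightOneSpectrum (𝓞 ℚ), ((3 : ℕ) : 𝓞 ℚ) ∉ v.asIdeal →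
      𝓖 (Sum.inr v) = 𝓚 (Sum.inr v) := fun v hv =>
    propagatedSelmerStructureOne_inr_eq_kummerSelmerStructure W 3 v hv (hbd v hv)
  have h𝓖unr : 𝓖.IsUnramifiedOutside (finSupport T) := by
    refine ⟨inl_mem_finSupport T, fun v hv => ?_⟩
    rw [inr_mem_finSupport_iff] at hv
    rw [heq v (fun h => hv (h3T v h))]
    exact h𝓚unr.2 v (by simpa using hv)
  have hinf : ∀ w : InfinitePlace ℚ, 𝓚 (Sum.inl w) = 𝓖 (Sum.inl w) := by
    intro w
    have h0 : ∀ x : galoisCohomology ((W.torsionGaloisModule ((3 : ℕ) : ℤ)).toLocal (Sum.inl w)) 1,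
        x = 0 := fun x =>
      galoisCohomology_one_torsion_eq_zero_infinitePlace_of_odd W w ⟨1, by norm_num⟩ x
    ext x
    rw [h0 x]
    exact ⟨fun _ => zero_mem _, fun _ => zero_mem _⟩
  -- the pair count
  have hpair := card_selmerGroup_pair (W.torsionGaloisModule ((3 : ℕ) : ℤ)) T inv hperf hsum hcompl
    hM hS hle h𝓚unr h𝓖unr hinf
  -- the local products: equal off `3`, ratio `3` at `3`
  set placeThree := (Rat.HeightOneSpectrum.primesEquiv (R := 𝓞 ℚ)).symm ⟨3, Nat.prime_three⟩
  have three_mem_placeThree : ((3 : ℕ) : 𝓞 ℚ) ∈ placeThree.asIdeal := three_mem_primesEquiv_symm_three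
  have hv₃T : placeThree ∈ T := h3T _ three_mem_placeThree
  have hT₃ : T.filter (fun v => ((3 : ℕ) : 𝓞 ℚ) ∈ v.asIdeal) = {placeThree} := by
    refine Finset.eq_singleton_iff_unique_mem.mpr ⟨?_, fun v hv => ?_⟩
    · exact Finset.mem_filter.mpr ⟨hv₃T, three_mem_placeThree⟩
    · exact heightOneSpectrum_eq_of_three_mem (Finset.mem_filter.mp hv).2 three_mem_placeThree
  have hK3 : Nat.card (𝓚 (Sum.inr placeThree)) =
      Nat.card (nsmulAddMonoidHom 3 :
        (W.baseChange (placeThree.adicCompletion ℚ)).toAffine.Point →+ _).ker * 3 := by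
    have h := W.natCard_kummerLocalConditionAt_adicCompletion placeThree (n := 3) (by norm_num)
    rw [natCard_quot_adicCompletionIntegers_three three_mem_placeThree] at h
    exact h
  have hprod : ∏ v ∈ T, Nat.card (𝓖 (Sum.inr v)) = 3 * ∏ v ∈ T, Nat.card (𝓚 (Sum.inr v)) := by
    rw [← Finset.prod_filter_mul_prod_filter_not T (fun v => ((3 : ℕ) : 𝓞 ℚ) ∈ v.asIdeal),
      ← Finset.prod_filter_mul_prod_filter_not T (fun v => ((3 : ℕ) : 𝓞 ℚ) ∈ v.asIdeal)
        (f := fun v => Nat.card (𝓚 (Sum.inr v))), hT₃,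
      Finset.prod_singleton, Finset.prod_singleton,
      Finset.prod_congr rfl (fun v hv => congrArg Nat.card
        (congrArg (fun H : AddSubgroup _ => (H : Type)) (heq v (Finset.mem_filter.mp hv).2))),
      hLpIm _ three_mem_placeThree, hK3]
    ring
  -- cancel
  have hKpos : 0 < Nat.card 𝓚.selmerGroup := Nat.card_pos
  have hPpos : 0 < ∏ v ∈ T, Nat.card (𝓚 (Sum.inr v)) :=
    Finset.prod_pos fun v _ => by
      haveI := W.finite_kummerSelmerStructure_inr v (n := 3) (by norm_num)
      exact Nat.card_pos
  unfold LocalInvariants.HasCoreRank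
  rw [pow_one]
  rw [hprod, ← hKSD] at hpair
  -- hpair : #𝓖Sel * #𝓚Sel * P = #𝓚Sel * #𝓖*Sel * (3 * P)
  have key : Nat.card 𝓖.selmerGroup * (Nat.card 𝓚.selmerGroup * ∏ v ∈ T, Nat.card (𝓚 (Sum.inr v))) =
      3 * Nat.card (inv.dualSelmerStructure _ 𝓖).selmerGroup *
        (Nat.card 𝓚.selmerGroup * ∏ v ∈ T, Nat.card (𝓚 (Sum.inr v))) := by
    calc _ = Nat.card 𝓖.selmerGroup * Nat.card 𝓚.selmerGroup * ∏ v ∈ T, Nat.card (𝓚 (Sum.inr v)) := by ring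
      _ = _ := hpair
      _ = _ := by ring
  exact Nat.eq_of_mul_eq_mul_right (Nat.mul_pos hKpos hPpos) key

end Summit.BirchSwinnertonDyer.Rank1Residual.GaloisImage

end
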